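/-
Copyright (c) 2026 the pub-hodgecm-mathlib formalisation cell (harness21).  Prover seat hodgecm-mathlib-K2E1-p13 (g3), Track B ∕ K2-LIT, h413 = `stmt-HodgeConjecture-24833`,
line `K2_E1_TraceFormulaBeta`, route of record `HCCMUnconditional`; dealer K2E1-plan (g7) (277): the ONE-SOURCE lemma «two continued scattering packages for the SAME basis agree» —
serving K2E1-p14's hB one-source flag (273)(ii) and K2E4-p10's G8 FILE 2 (agreement of a matrix ball package with ★ p860855's `qc` on the tube).
-/
import Summits.HodgeConjecture.HodgeConjecture.Theorems.K2E1ScatteringConjSymmetryPairU      -- ★ p860821 (this seat): brings ★ `countable_of_codiscrete`, ★ `isPreconnected_convex_diff_of_countable`, the U(1,1) currency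
import HarnessLib

/-!
# K2·E1 — `K2E1ChiScatteringPackageUniqueU2`: TWO CONTINUED SCATTERING PACKAGES FOR THE SAME BASIS AGREE — `q = q′` on the tube (linear independence) and `qc = qc′` off `P ∪ P′`
# (identity theorem on the co-countable complement); the continued family `Ec` likewise

Track B ∕ K2-LIT, crux h413 = `stmt-HodgeConjecture-24833`; cell `hodgecm-mathlib`, squad K2, ENGINE E1 (consumers: the (SD) M1 assembly's one-source flag — ★ p860833's `hB` package vs ★
p860788's package; AMENDMENT #3 G8 FILE 2 — a matrix ball package vs ★ p860855's global `qc`; every «two obtains of an ∃-package» situation).  THEOREMS ONLY (no `def`, no `instance`, no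
notation, no named-fact hypothesis, no `sorry`; default heartbeats); lane `--kind proof --supports stmt-HodgeConjecture-24833 --as helper` (count-neutral).  Closes no socket.

THE MATHEMATICS ([BernsteinLapid2019, Thm 2.3, §5]; [MoeglinWaldspurger1995, IV.1.8–IV.1.10]).  A continued scattering package `(q, qc, P)` for a section `φ` and a basis `b_j` of the dual
section space consists of: tube coordinates with `Σ_j q_j(z)·b_j = F(z)` (`F` = the Godement-range function of `φ`, the SAME for every package), continuations `qc_j` analytic off a closed
co-discrete `P` with `qc_j = q_j` on the tube (★ X2_χ ∕ (α) ∕ G3 clause shapes).  Two such packages AGREE: on the tube `Σ_j (q_j − q′_j)(z)·b_j = 0`, so `q = q′` by linear independence (§1);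
off `P ∪ P′` (countable, ★ `countable_of_codiscrete`) the complement is open and preconnected (★ `isPreconnected_convex_diff_of_countable`), contains a point of the open tube, and
`qc_j = q_j = q′_j = qc′_j` near it, so `qc_j = qc′_j` on all of `(P ∪ P′)ᶜ` by the identity theorem (§2, stated for any complete normed target — also the continued series `z ↦ Ec z g`).
§3 packages this as **`package_unique`** (hypothesis-first on the clause letters, any right-hand side `F`) and the `U(1,1)_{L∕L⁺}` print **`chi_scattering_package_unique_cm_two`** in the
(α)∕★ p860855 byte shape of `hqφ`.  No positivity, no `P ⊆ {Re ≤ 1}` needed.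
HONEST LABEL: HC_CM is proved only modulo the 7 printed citations (2 remaining named inputs: hLiu418 = `stmt-HodgeConjecture-24832`, h413 = `stmt-HodgeConjecture-24833`) until rung 0
closes; this file asserts no named fact and closes no socket; count-neutral.

## References
* [BernsteinLapid2019] J. Bernstein, E. Lapid, *On the meromorphic continuation of Eisenstein series*, J. AMS 37 (2024), Thm 2.3, §5.
* [MoeglinWaldspurger1995] C. Mœglin, J.-L. Waldspurger, *Spectral decomposition and Eisenstein series* (1995), IV.1.8–IV.1.10.
-/

set_option autoImplicit false
set_option linter.dupNamespace false  -- the mandated namespace repeats the summit's segment (`HodgeConjecture.HodgeConjecture`)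

noncomputable section

open MeasureTheory Set Filter Topology NumberField IsDedekindDomain
open scoped NNReal
open Literature.NumberTheory.Automorphic Literature.NumberTheory.Automorphic.UnitaryGroup AdelicGroupData
open Summit.HodgeConjecture.HodgeConjecture.Cruxes.H413.K2E1BorelEisensteinU
open Summit.HodgeConjecture.HodgeConjecture.Cruxes.H413.K2E1ConvexDiffCountableConnected (countable_of_codiscrete isPreconnected_convex_diff_of_countable)

namespace Summit.HodgeConjecture.HodgeConjecture.Cruxes.H413.K2E1ChiScatteringPackageUniqueU2

/-! ## §1 Coefficient extraction on the tube -/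

/-- **Coordinates against a linearly independent finite family are unique**: `Σ_j c_j•b_j = Σ_j c′_j•b_j ⟹ c = c′`. [folklore] -/
theorem coords_eq_of_sum_smul_eq {X ι : Type*} [Fintype ι] {b : ι → X → ℂ} (hb : LinearIndependent ℂ b) {c c' : ι → ℂ}
    (h : ∑ j, c j • b j = ∑ j, c' j • b j) : c = c' := by
  have h0 : ∑ j, (c j - c' j) • b j = 0 := by
    simp only [sub_smul, Finset.sum_sub_distrib, h, sub_self]
  funext j
  exact sub_eq_zero.1 (Fintype.linearIndependent_iff.1 hb (fun j => c j - c' j) h0 j)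

/-- **Tube coordinates with the same right-hand side agree**: `Σ_j q_j(z)•b_j = F z = Σ_j q′_j(z)•b_j` for `1 < Re z` ⟹ `q_j = q′_j` there. [cite: BernsteinLapid2019, §5] -/
theorem tube_coords_eq {X ι : Type*} [Fintype ι] {b : ι → X → ℂ} (hb : LinearIndependent ℂ b) {F : ℂ → X → ℂ} {q q' : ι → ℂ → ℂ}
    (hq : ∀ z : ℂ, 1 < z.re → (∑ j, q j z • b j) = F z) (hq' : ∀ z : ℂ, 1 < z.re → (∑ j, q' j z • b j) = F z) :
    ∀ j (z : ℂ), 1 < z.re → q j z = q' j z := fun j z hz =>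
  congrFun (coords_eq_of_sum_smul_eq hb (c := fun j => q j z) (c' := fun j => q' j z) ((hq z hz).trans (hq' z hz).symm)) j

/-! ## §2 Continuations agreeing on the tube agree off the exceptional sets -/

/-- **IDENTITY THEOREM OFF TWO CO-DISCRETE SETS**: `f` analytic off `P`, `g` analytic off `P′` (both co-discrete, hence countable), `f = g` on the open tube `{1 < Re}` ⟹ `f = g` off `P ∪ P′`
(the complement of a countable set is preconnected, ★ `isPreconnected_convex_diff_of_countable`; a tube point off `P ∪ P′` exists by density). [cite: BernsteinLapid2019, Thm 2.3, §5]
[cite: MoeglinWaldspurger1995, IV.1.10] -/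
theorem eqOn_of_eqOn_tube {𝓔 : Type*} [NormedAddCommGroup 𝓔] [NormedSpace ℂ 𝓔] [CompleteSpace 𝓔] {P P' : Set ℂ} {f g : ℂ → 𝓔}
    (hPcd : ∀ z₀ : ℂ, ∀ᶠ s in 𝓝[≠] z₀, s ∉ P) (hP'cd : ∀ z₀ : ℂ, ∀ᶠ s in 𝓝[≠] z₀, s ∉ P')
    (hf : ∀ z : ℂ, z ∉ P → AnalyticAt ℂ f z) (hg : ∀ z : ℂ, z ∉ P' → AnalyticAt ℂ g z) (htube : ∀ z : ℂ, 1 < z.re → f z = g z) :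
    ∀ z : ℂ, z ∉ P → z ∉ P' → f z = g z := by
  intro z hz hz'
  have hcount : (P ∪ P').Countable := (countable_of_codiscrete hPcd).union (countable_of_codiscrete hP'cd)
  have hpre : IsPreconnected (univ \ (P ∪ P')) := isPreconnected_convex_diff_of_countable Literature.Topology.Euclidean.one_lt_rank_real_complex convex_univ isOpen_univ hcount
  have hfA : AnalyticOnNhd ℂ f (univ \ (P ∪ P')) := fun w hw => hf w fun h => hw.2 (Or.inl h)
  have hgA : AnalyticOnNhd ℂ g (univ \ (P ∪ P')) := fun w hw => hg w fun h => hw.2 (Or.inr h)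
  -- a tube point off `P ∪ P′`
  have hopen : IsOpen {w : ℂ | 1 < w.re} := isOpen_lt continuous_const Complex.continuous_re
  obtain ⟨z₁, hz₁t, hz₁S⟩ := (hcount.dense_compl ℂ).inter_open_nonempty _ hopen ⟨2, by simp⟩
  have hev : f =ᶠ[𝓝 z₁] g := by
    filter_upwards [hopen.mem_nhds hz₁t] with w hw using htube w hw
  exact hfA.eqOn_of_preconnected_of_eventuallyEq hgA hpre ⟨mem_univ _, hz₁S⟩ hev ⟨mem_univ _, fun h => h.elim hz hz'⟩

/-! ## §3 The package print -/

/-- **TWO CONTINUED SCATTERING PACKAGES FOR THE SAME BASIS AGREE** (hypothesis-first on the clause letters, any right-hand side `F`): coordinates `q, q′` with `Σ_j q_j(z)•b_j = F z = Σ_j q′_j(z)•b_j`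
on the tube, continuations `qc, qc′` analytic off co-discrete `P, P′` with `qc = q`, `qc′ = q′` on the tube ⟹ `q = q′` on the tube AND `qc = qc′` off `P ∪ P′`.
[cite: BernsteinLapid2019, Thm 2.3, §5] [cite: MoeglinWaldspurger1995, IV.1.8–IV.1.10] -/
theorem package_unique {X ι : Type*} [Fintype ι] {b : ι → X → ℂ} (hb : LinearIndependent ℂ b) {F : ℂ → X → ℂ}
    {q qc q' qc' : ι → ℂ → ℂ} {P P' : Set ℂ}
    (hq : ∀ z : ℂ, 1 < z.re → (∑ j, q j z • b j) = F z) (hq' : ∀ z : ℂ, 1 < z.re → (∑ j, q' j z • b j) = F z)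
    (hqcq : ∀ j (z : ℂ), 1 < z.re → qc j z = q j z) (hqcq' : ∀ j (z : ℂ), 1 < z.re → qc' j z = q' j z)
    (hPcd : ∀ z₀ : ℂ, ∀ᶠ s in 𝓝[≠] z₀, s ∉ P) (hP'cd : ∀ z₀ : ℂ, ∀ᶠ s in 𝓝[≠] z₀, s ∉ P')
    (hqa : ∀ j (z : ℂ), z ∉ P → AnalyticAt ℂ (qc j) z) (hqa' : ∀ j (z : ℂ), z ∉ P' → AnalyticAt ℂ (qc' j) z) :
    (∀ j (z : ℂ), 1 < z.re → q j z = q' j z) ∧ ∀ j (z : ℂ), z ∉ P → z ∉ P' → qc j z = qc' j z := by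
  have htube := tube_coords_eq hb hq hq'
  exact ⟨htube, fun j => eqOn_of_eqOn_tube hPcd hP'cd (hqa j) (hqa' j) fun z hz => by rw [hqcq j z hz, hqcq' j z hz, htube j z hz]⟩

/-- **TWO CONTINUATIONS OF THE SAME SERIES AGREE**: `Ec z = E(f_z^φ) = Ec′ z` on the tube (the (E1) clauses), `z ↦ Ec z g`, `z ↦ Ec′ z g` analytic off co-discrete `P, P′` ⟹ `Ec z g = Ec′ z g` off
`P ∪ P′` (§2 per `g`). [cite: BernsteinLapid2019, Thm 2.3] -/
theorem continued_eq_of_tube {X : Type*} {Ec Ec' : ℂ → X → ℂ} {E₀ : ℂ → X → ℂ} {P P' : Set ℂ}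
    (hE1 : ∀ z : ℂ, 1 < z.re → Ec z = E₀ z) (hE1' : ∀ z : ℂ, 1 < z.re → Ec' z = E₀ z)
    (hPcd : ∀ z₀ : ℂ, ∀ᶠ s in 𝓝[≠] z₀, s ∉ P) (hP'cd : ∀ z₀ : ℂ, ∀ᶠ s in 𝓝[≠] z₀, s ∉ P')
    (hEan : ∀ g (z : ℂ), z ∉ P → AnalyticAt ℂ (fun z => Ec z g) z) (hEan' : ∀ g (z : ℂ), z ∉ P' → AnalyticAt ℂ (fun z => Ec' z g) z) :
    ∀ g (z : ℂ), z ∉ P → z ∉ P' → Ec z g = Ec' z g := fun g =>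
  eqOn_of_eqOn_tube hPcd hP'cd (hEan g) (hEan' g) fun z hz => by
    show Ec z g = Ec' z g
    rw [hE1 z hz, hE1' z hz]

/-! ### The `U(1,1)_{L∕L⁺}` print in the (α) ∕ G3 byte shape -/

section CM

variable (L : Type) [Field L] [NumberField L] [IsCMField L]
variable [MeasurableSpace (quasiSplit (↥(maximalRealSubfield L)) L (IsCMField.complexConj L) 2).Adelic]

/-- **ONE SOURCE UP TO EQUALITY: two continued scattering packages of `U(1,1)_{L∕L⁺}` for the same section `φ` and the same basis functions `b_j` agree** — `hqφ`, `hqcq`, `hPcd`, `hqa` in the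
★ (α) p860621 ∕ ★ G3 p860855 ∕ ★ K2E4-p14 §3 byte shapes (`b j := ⇑(bV j)`): `q = q′` on the tube and `qc = qc′` off `P ∪ P′`; with the (E1)∕(E4) clauses also `Ec = Ec′` off `P ∪ P′`.
[cite: BernsteinLapid2019, Thm 2.3, §5] [cite: MoeglinWaldspurger1995, IV.1.8–IV.1.10] -/
theorem chi_scattering_package_unique_cm_two
    (ν : Measure ↥(adelicUnipotent (↥(maximalRealSubfield L)) L (IsCMField.complexConj L) 2)) (𝓕 : Set ↥(adelicUnipotent (↥(maximalRealSubfield L)) L (IsCMField.complexConj L) 2)) {φ : (quasiSplit (↥(maximalRealSubfield L)) L (IsCMField.complexConj L) 2).Adelic → ℂ}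
    {ι : Type*} [Fintype ι] {b : ι → (quasiSplit (↥(maximalRealSubfield L)) L (IsCMField.complexConj L) 2).Adelic → ℂ} (hb : LinearIndependent ℂ b)
    {q qc q' qc' : ι → ℂ → ℂ} {Ec Ec' : ℂ → (quasiSplit (↥(maximalRealSubfield L)) L (IsCMField.complexConj L) 2).Adelic → ℂ} {P P' : Set ℂ}
    (hqφ : ∀ z : ℂ, 1 < z.re → (∑ j, q j z • b j) = ((((ν 𝓕).toReal⁻¹ : ℝ)) : ℂ) • (fun g : (quasiSplit (↥(maximalRealSubfield L)) L (IsCMField.complexConj L) 2).Adelic => (∫ v : ↥(adelicUnipotent (↥(maximalRealSubfield L)) L (IsCMField.complexConj L) 2), flatSectionU φ z ((quasiSplit (↥(maximalRealSubfield L)) L (IsCMField.complexConj L) 2).toAdelic (weylLongU ((IsCMField.complexConj L : L ≃ₐ[↥(maximalRealSubfield L)] L) : L →+* L) (rfl : (StdForm.antidiagonal 2).over L = (StdForm.antidiagonal 2).over L)) * ((v : (quasiSplit (↥(maximalRealSubfield L)) L (IsCMField.complexConj L) 2).Adelic) * g)) ∂ν) * (((borelHeight g : ℝ) : ℂ) ^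 (z - 1))))
    (hqφ' : ∀ z : ℂ, 1 < z.re → (∑ j, q' j z • b j) = ((((ν 𝓕).toReal⁻¹ : ℝ)) : ℂ) • (fun g : (quasiSplit (↥(maximalRealSubfield L)) L (IsCMField.complexConj L) 2).Adelic => (∫ v : ↥(adelicUnipotent (↥(maximalRealSubfield L)) L (IsCMField.complexConj L) 2), flatSectionU φ z ((quasiSplit (↥(maximalRealSubfield L)) L (IsCMField.complexConj L) 2).toAdelic (weylLongU ((IsCMField.complexConj L : L ≃ₐ[↥(maximalRealSubfield L)] L) : L →+* L) (rfl : (StdForm.antidiagonal 2).over L = (StdForm.antidiagonal 2).over L)) * ((v : (quasiSplit (↥(maximalRealSubfield L)) L (IsCMField.complexConj L) 2).Adelic) * g)) ∂ν) * (((borelHeight g : ℝ) : ℂ) ^ (z - 1))))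
    (hE1 : ∀ z : ℂ, 1 < z.re → Ec z = eisensteinSeriesU (flatSectionU φ z)) (hE1' : ∀ z : ℂ, 1 < z.re → Ec' z = eisensteinSeriesU (flatSectionU φ z))
    (hqcq : ∀ j (z : ℂ), 1 < z.re → qc j z = q j z) (hqcq' : ∀ j (z : ℂ), 1 < z.re → qc' j z = q' j z)
    (hPcd : ∀ z₀ : ℂ, ∀ᶠ s in 𝓝[≠] z₀, s ∉ P) (hP'cd : ∀ z₀ : ℂ, ∀ᶠ s in 𝓝[≠] z₀, s ∉ P')
    (hEan : ∀ g (z : ℂ), z ∉ P → AnalyticAt ℂ (fun z => Ec z g) z) (hEan' : ∀ g (z : ℂ), z ∉ P' → AnalyticAt ℂ (fun z => Ec' z g) z)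
    (hqa : ∀ j (z : ℂ), z ∉ P → AnalyticAt ℂ (qc j) z) (hqa' : ∀ j (z : ℂ), z ∉ P' → AnalyticAt ℂ (qc' j) z) :
    (∀ j (z : ℂ), 1 < z.re → q j z = q' j z) ∧ (∀ j (z : ℂ), z ∉ P → z ∉ P' → qc j z = qc' j z) ∧
      ∀ g (z : ℂ), z ∉ P → z ∉ P' → Ec z g = Ec' z g := by
  obtain ⟨h1, h2⟩ := package_unique hb hqφ hqφ' hqcq hqcq' hPcd hP'cd hqa hqa'
  exact ⟨h1, h2, continued_eq_of_tube hE1 hE1' hPcd hP'cd hEan hEan'⟩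

end CM

end Summit.HodgeConjecture.HodgeConjecture.Cruxes.H413.K2E1ChiScatteringPackageUniqueU2

end
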